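import Mathlib
import Summits.QuantumFields.QCD.Theses.PauliWegnerSea
import Literature.MathematicalPhysics.QuantumFieldTheory.QCDPhaseQuenchedMomentUpgrade
import Literature.MathematicalPhysics.QuantumFieldTheory.QCDHeavyQuarkPropagator
import Literature.MathematicalPhysics.QuantumFieldTheory.QCDWickMinorMeasurability
import Literature.MathematicalPhysics.QuantumFieldTheory.FermiFlavourPhase
import Literature.Probability.LatticeModels.TorusCentredLift
import Literature.Probability.LatticeModels.TorusCentredTimeSeparation
import Literature.Probability.Moments.CrossingSplitTransfer

/-!
# Stub `stub_decayTransfer` of line `crossing-split-integrability`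
(crux `Summit.QuantumFields.QCD.Theses.PauliWegnerSea.PhaseQuenchedFlavourDecay` =
`Summit.QuantumFields.QCD.Theses.WilsonMobilityGap.PhaseQuenchedFlavourDecay`, item stmt-QuantumFields-9151)

The crossing split ("decay is free"): SplitBound → CrossingLaplace → TwoPointDecay → MinorMoments →
MinorDecay.  Given (i) the abstract Hölder/Markov split inequality, (ii) the algebraic two-sided
Laplace bound for flavour-block matrices with small crossing entries, (iii) fractional-moment
(`s < 1`, rate `δ`) decay of the colour–spin block sums of the quark propagator between any two
torus sites and (iv) `r`-uniform `(1+ε)`-moments of all Wick minors under the phase-quenched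
measure, the phase-quenched first moments of all flavour-charged two-box Wick minors decay at the
rate `δ' = δ · min ((1 - s/2) ε/(1+ε)) (ε/(2(1+2ε)))` in the time separation `n` of the boxes.

Proof: in the degenerate case `∫ |det D| dμ_W = 0` both the measure and `⟨·⟩₊` vanish; otherwise
`qcdLatticeMeasure` is a probability measure and `⟨·⟩₊` is its integral.  The crossing entries of
the minor's matrix sit at torus sites `proj u`, `proj (u' + n e₀)` (`u ∈ Λ_R`, `u' ∈ Λ_{R'}`), i.e.
at `(x, x + proj v)` with `v ∈ Λ_S`, `‖v‖ ≥ n - R - R'` (`TorusCentredTimeSeparation`), so each is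
dominated by a block sum whose `s`-moment is `≤ C e^{-δ a_k ‖v‖}` (TwoPointDecay); off-flavour
entries vanish; CrossingLaplace bounds the minor by `η · K · (Σ sub-minors)²` when all crossing
entries are `≤ η ≤ 1` (the flavour charge is non-zero), and every sub-minor is a Wick minor of size
`≤ r` with first moment `≤ 1 + C_i` (MinorMoments); the abstract transfer
`integral_le_exp_of_crossing_split` (`CrossingSplitTransfer`) assembles these with the split
inequality.
-/

noncomputable section

namespace Summit.QuantumFields.QCD.Cruxes.PhaseQuenchedFlavourDecay.CrossingSplitIntegrability

open scoped BigOperators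
open MeasureTheory Filter
open Literature.MathematicalPhysics.QuantumFieldTheory Literature.MathematicalPhysics.QuantumLattice
  Literature.Probability.LatticeModels Literature.Probability.Moments


/-- Registered stub `stub_decayTransfer` of line `crossing-split-integrability` for crux stmt-QuantumFields-9151:
the crossing split: SplitBound -> CrossingLaplace -> TwoPointDecay -> MinorMoments -> MinorDecay. -/
theorem stub_decayTransfer :
      (∀ (Ω : Type) [MeasurableSpace Ω] (ν : Measure Ω) [IsProbabilityMeasure ν] (X Y G : Ω → ℝ) (ε η : ℝ) (q : ℕ),
        0 < ε → 0 < η → η ≤ 1 → (∀ ω, 0 ≤ X ω) → (∀ ω, 0 ≤ Y ω) → Measurable X → Measurable Y → Measurable G →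
        Integrable (fun ω => X ω ^ (1 + ε)) ν → Integrable (fun ω => Real.sqrt (Y ω)) ν →
        (∀ ω, G ω ≤ η → X ω ≤ η ^ q * Y ω) →
          ∫ ω, X ω ∂ν ≤
            (∫ ω, X ω ^ (1 + ε) ∂ν) ^ (1 / (1 + ε)) * (ν {ω | η < G ω}).toReal ^ (ε / (1 + ε)) +
              η ^ ((q : ℝ) * ε / (1 + 2 * ε)) * (∫ ω, Real.sqrt (Y ω) ∂ν) ^ (2 * ε / (1 + 2 * ε)) *
                (∫ ω, X ω ^ (1 + ε) ∂ν) ^ (1 / (1 + 2 * ε))) →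
      (∀ r : ℕ, ∃ K : ℝ, 0 ≤ K ∧
        ∀ (Φ : Type) [DecidableEq Φ] (M : Matrix (Fin r) (Fin r) ℂ) (φr φc : Fin r → Φ) (sr sc : Fin r → Bool)
          (f₀ : Φ) (η : ℝ), 0 ≤ η → η ≤ 1 →
          (∀ a b, φr a ≠ φc b → M a b = 0) →
          (∀ a b, sr a ≠ sc b → ‖M a b‖ ≤ η) →
            ‖M.det‖ ≤
              η ^ (((Finset.univ.filter fun a => φr a = f₀ ∧ sr a = true).card : ℤ) -
                    ((Finset.univ.filter fun b => φc b = f₀ ∧ sc b = true).card : ℤ)).natAbs * K *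
                ∑ i : Fin (r + 1), ∑ j : Fin (r + 1),
                  ∑ e₁ : Fin (i : ℕ) → {a // sr a = true}, ∑ e₂ : Fin (i : ℕ) → {b // sc b = true},
                    ∑ e₃ : Fin (j : ℕ) → {a // sr a = false}, ∑ e₄ : Fin (j : ℕ) → {b // sc b = false},
                      ‖(M.submatrix (fun t => (e₁ t).1) (fun t => (e₂ t).1)).det‖ *
                        ‖(M.submatrix (fun t => (e₃ t).1) (fun t => (e₄ t).1)).det‖) →
    ∀ (Nf : ℕ) (reg : QCDRegularisation Nf) (m : Fin Nf → ℝ),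
      (∃ s δ C : ℝ, 0 < s ∧ s < 1 ∧ 0 < δ ∧ ∀ᶠ k in atTop, ∀ S : ℕ, reg.L k ≤ S →
        ∀ (f : Fin Nf) (x : TorusSite 4 (2 * S + 1)) (v : Literature.Probability.LatticeModels.Site 4), v ∈ box 4 S →
          Integrable (fun U : GaugeConfig 4 (2 * S + 1) SU3 =>
              (∑ a : Fin 3, ∑ i : Fin 4, ∑ b : Fin 3, ∑ j : Fin 4,
                ‖(diracMatrix U fun fl => reg.mcrit k + reg.a k * m fl / reg.Zm k)⁻¹ (quarkEquiv (f, (x, a, i)))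
                  (quarkEquiv (f, (x + Torus.proj (2 * S + 1) v, b, j)))‖) ^ s)
              (qcdLatticeMeasure (2 * S + 1) (reg.β k) fun fl => reg.mcrit k + reg.a k * m fl / reg.Zm k) ∧
            qcdPhaseQuenchedExpect (reg.β k) (2 * S + 1) (fun fl => reg.mcrit k + reg.a k * m fl / reg.Zm k)
                (fun U : GaugeConfig 4 (2 * S + 1) SU3 =>
                  (∑ a : Fin 3, ∑ i : Fin 4, ∑ b : Fin 3, ∑ j : Fin 4,
                    ‖(diracMatrix U fun fl => reg.mcrit k + reg.a k * m fl / reg.Zm k)⁻¹ (quarkEquiv (f, (x, a, i)))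
                      (quarkEquiv (f, (x + Torus.proj (2 * S + 1) v, b, j)))‖) ^ s) ≤
              C * Real.exp (-(δ * (reg.a k * ‖v‖)))) →
      (∃ ε : ℝ, 0 < ε ∧ ∀ r : ℕ, ∃ C : ℝ, ∀ᶠ k in atTop, ∀ S : ℕ, reg.L k ≤ S →
        ∀ I J : Fin r → QuarkVar Nf (2 * S + 1),
          Integrable (fun U : GaugeConfig 4 (2 * S + 1) SU3 =>
              ‖(Matrix.of fun a b : Fin r => (diracMatrix U fun fl => reg.mcrit k + reg.a k * m fl / reg.Zm k)⁻¹
                (quarkEquiv (I a)) (quarkEquiv (J b))).det‖ ^ (1 + ε))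
              (qcdLatticeMeasure (2 * S + 1) (reg.β k) fun fl => reg.mcrit k + reg.a k * m fl / reg.Zm k) ∧
            qcdPhaseQuenchedExpect (reg.β k) (2 * S + 1) (fun fl => reg.mcrit k + reg.a k * m fl / reg.Zm k)
                (fun U : GaugeConfig 4 (2 * S + 1) SU3 =>
                  ‖(Matrix.of fun a b : Fin r => (diracMatrix U fun fl => reg.mcrit k + reg.a k * m fl / reg.Zm k)⁻¹
                    (quarkEquiv (I a)) (quarkEquiv (J b))).det‖ ^ (1 + ε)) ≤ C) →
      (∃ δ' : ℝ, 0 < δ' ∧ ∀ r R R' : ℕ, ∃ C : ℝ, ∀ᶠ k in atTop, ∀ S : ℕ, reg.L k ≤ S → ∀ n : ℕ, n ≤ S →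
        ∀ (κ ρ : Fin r → BoxQuarkVar Nf R ⊕ BoxQuarkVar Nf R') (f₀ : Fin Nf),
          ((Finset.univ.filter fun a => Sum.isLeft (κ a) = true ∧
              Sum.elim (fun v : BoxQuarkVar Nf R => v.1) (fun v : BoxQuarkVar Nf R' => v.1) (κ a) = f₀).card : ℤ) -
            ((Finset.univ.filter fun b => Sum.isLeft (ρ b) = true ∧
              Sum.elim (fun v : BoxQuarkVar Nf R => v.1) (fun v : BoxQuarkVar Nf R' => v.1) (ρ b) = f₀).card : ℤ) ≠ 0 →
          Integrable (fun U : GaugeConfig 4 (2 * S + 1) SU3 =>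
              ‖(Matrix.of fun a b : Fin r => (diracMatrix U fun fl => reg.mcrit k + reg.a k * m fl / reg.Zm k)⁻¹
                (quarkEquiv (Sum.elim
                  (fun v : BoxQuarkVar Nf R =>
                    (v.1, (Torus.proj (2 * S + 1) (v.2.1 : Literature.Probability.LatticeModels.Site 4), v.2.2)))
                  (fun v : BoxQuarkVar Nf R' =>
                    (v.1, (Torus.proj (2 * S + 1)
                      ((v.2.1 : Literature.Probability.LatticeModels.Site 4) + Pi.single 0 (n : ℤ)), v.2.2)))
                  (κ a)))
                (quarkEquiv (Sum.elim
                  (fun v : BoxQuarkVar Nf R =>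
                    (v.1, (Torus.proj (2 * S + 1) (v.2.1 : Literature.Probability.LatticeModels.Site 4), v.2.2)))
                  (fun v : BoxQuarkVar Nf R' =>
                    (v.1, (Torus.proj (2 * S + 1)
                      ((v.2.1 : Literature.Probability.LatticeModels.Site 4) + Pi.single 0 (n : ℤ)), v.2.2)))
                  (ρ b)))).det‖)
              (qcdLatticeMeasure (2 * S + 1) (reg.β k) fun fl => reg.mcrit k + reg.a k * m fl / reg.Zm k) ∧
            qcdPhaseQuenchedExpect (reg.β k) (2 * S + 1) (fun fl => reg.mcrit k + reg.a k * m fl / reg.Zm k)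
                (fun U : GaugeConfig 4 (2 * S + 1) SU3 =>
                  ‖(Matrix.of fun a b : Fin r => (diracMatrix U fun fl => reg.mcrit k + reg.a k * m fl / reg.Zm k)⁻¹
                    (quarkEquiv (Sum.elim
                      (fun v : BoxQuarkVar Nf R =>
                        (v.1, (Torus.proj (2 * S + 1) (v.2.1 : Literature.Probability.LatticeModels.Site 4), v.2.2)))
                      (fun v : BoxQuarkVar Nf R' =>
                        (v.1, (Torus.proj (2 * S + 1)
                          ((v.2.1 : Literature.Probability.LatticeModels.Site 4) + Pi.single 0 (n : ℤ)), v.2.2)))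
                      (κ a)))
                    (quarkEquiv (Sum.elim
                      (fun v : BoxQuarkVar Nf R =>
                        (v.1, (Torus.proj (2 * S + 1) (v.2.1 : Literature.Probability.LatticeModels.Site 4), v.2.2)))
                      (fun v : BoxQuarkVar Nf R' =>
                        (v.1, (Torus.proj (2 * S + 1)
                          ((v.2.1 : Literature.Probability.LatticeModels.Site 4) + Pi.single 0 (n : ℤ)), v.2.2)))
                      (ρ b)))).det‖) ≤
              C * Real.exp (-(δ' * (reg.a k * n)))) := by
  intro hSplit hCL Nf reg m hTP hMM
  obtain ⟨s, δ, CT, hs0, hs1, hδ, hTP⟩ := hTP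
  obtain ⟨ε, hε, hMM⟩ := hMM
  choose CM hMM using hMM
  choose K hK0 hCL using hCL
  -- the rate
  obtain ⟨γ, hγ⟩ : ∃ γ : ℝ, γ = min ((1 - s / 2) * ε / (1 + ε)) (ε / (2 * (1 + 2 * ε))) := ⟨_, rfl⟩
  have hγ0 : 0 < γ := by
    rw [hγ]
    refine lt_min ?_ (by positivity)
    have : 0 < 1 - s / 2 := by linarith
    positivity
  refine ⟨γ * δ, mul_pos hγ0 hδ, fun r R R' => ?_⟩
  -- the constants for `(r, R, R')`
  obtain ⟨CA, hCA⟩ : ∃ CA : ℝ, CA = max (CM r) 0 := ⟨_, rfl⟩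
  obtain ⟨CT', hCT'⟩ : ∃ CT' : ℝ, CT' = max CT 0 := ⟨_, rfl⟩
  obtain ⟨CW, hCW⟩ : ∃ CW : ℝ, CW =
      ∑ τ : (i : Fin (r + 1)) × ((Fin (i : ℕ) → Fin r) × (Fin (i : ℕ) → Fin r)), (1 + max (CM τ.1) 0) :=
    ⟨_, rfl⟩
  obtain ⟨K₀, hK₀⟩ : ∃ K₀ : ℝ, K₀ = CA ^ (1 / (1 + ε)) * ((r : ℝ) ^ 2 * CT') ^ (ε / (1 + ε)) +
      (Real.sqrt (K r) * CW) ^ (2 * ε / (1 + 2 * ε)) * CA ^ (1 / (1 + 2 * ε)) := ⟨_, rfl⟩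
  have hCA0 : 0 ≤ CA := by rw [hCA]; exact le_max_right _ _
  have hCT0 : 0 ≤ CT' := by rw [hCT']; exact le_max_right _ _
  have hCW0 : 0 ≤ CW := by rw [hCW]; positivity
  have hK₀0 : 0 ≤ K₀ := by rw [hK₀]; have := hK0 r; positivity
  refine ⟨K₀ * Real.exp (γ * δ * ((R : ℝ) + R')), ?_⟩
  -- the eventual set
  have ha1 : ∀ᶠ k in atTop, reg.a k ≤ 1 := reg.tendsto_a.eventually (Iic_mem_nhds one_pos)
  filter_upwards [hTP, hMM r, Filter.eventually_all.2 fun i : Fin (r + 1) => hMM i, ha1] with k hTPk hMMr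
    hMMi ha1k
  intro S hS n hn κ ρ f₀ hq
  have hak := reg.a_pos k
  -- abbreviations
  set mq : Fin Nf → ℝ := fun fl => reg.mcrit k + reg.a k * m fl / reg.Zm k with hmq
  set ν := qcdLatticeMeasure (2 * S + 1) (reg.β k) mq with hν
  set fl : BoxQuarkVar Nf R ⊕ BoxQuarkVar Nf R' → Fin Nf :=
    Sum.elim (fun v : BoxQuarkVar Nf R => v.1) (fun v : BoxQuarkVar Nf R' => v.1) with hfl
  set PL : BoxQuarkVar Nf R ⊕ BoxQuarkVar Nf R' → QuarkVar Nf (2 * S + 1) :=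
    Sum.elim
      (fun v : BoxQuarkVar Nf R =>
        (v.1, (Torus.proj (2 * S + 1) (v.2.1 : Literature.Probability.LatticeModels.Site 4), v.2.2)))
      (fun v : BoxQuarkVar Nf R' =>
        (v.1, (Torus.proj (2 * S + 1)
          ((v.2.1 : Literature.Probability.LatticeModels.Site 4) + Pi.single 0 (n : ℤ)), v.2.2))) with hPL
  set X : GaugeConfig 4 (2 * S + 1) SU3 → ℝ := fun U =>
    ‖(Matrix.of fun a b : Fin r => (diracMatrix U mq)⁻¹ (quarkEquiv (PL (κ a))) (quarkEquiv (PL (ρ b)))).det‖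
    with hX
  -- the degenerate case
  by_cases hZ : ∫ U, ‖(diracMatrix U mq).det‖
      ∂(wilsonMeasure (d := 4) (L := 2 * S + 1) (fundamentalRep (Fin 3)) (reg.β k)) = 0
  · rw [hν, qcdLatticeMeasure_eq_zero_of_integral_eq_zero _ _ hZ,
      qcdPhaseQuenchedExpect_eq_zero_of_integral_eq_zero _ _ hZ]
    exact ⟨integrable_zero_measure, by positivity⟩
  have hZpos : 0 < ∫ U, ‖(diracMatrix U mq).det‖
      ∂(wilsonMeasure (d := 4) (L := 2 * S + 1) (fundamentalRep (Fin 3)) (reg.β k)) :=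
    lt_of_le_of_ne (integral_nonneg fun _ => norm_nonneg _) (Ne.symm hZ)
  haveI := isProbabilityMeasure_qcdLatticeMeasure (S := 2 * S + 1) (reg.β k) mq hZpos
  rw [qcdPhaseQuenchedExpect_eq_integral_qcdLatticeMeasure]
  -- the matrix of the minor, its sub-minors
  set M : GaugeConfig 4 (2 * S + 1) SU3 → Matrix (Fin r) (Fin r) ℂ := fun U =>
    Matrix.of fun a b : Fin r => (diracMatrix U mq)⁻¹ (quarkEquiv (PL (κ a))) (quarkEquiv (PL (ρ b))) with hM
  set W : GaugeConfig 4 (2 * S + 1) SU3 → ℝ := fun U =>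
    ∑ τ : (i : Fin (r + 1)) × ((Fin (i : ℕ) → Fin r) × (Fin (i : ℕ) → Fin r)),
      ‖((M U).submatrix τ.2.1 τ.2.2).det‖ with hW
  -- (1) moments of the minor and of its sub-minors
  obtain ⟨hXi, hXA⟩ := hMMr S hS (fun a => PL (κ a)) (fun b => PL (ρ b))
  rw [qcdPhaseQuenchedExpect_eq_integral_qcdLatticeMeasure] at hXA
  obtain ⟨hXint, -⟩ := integrable_norm_det_inv_diracMatrix_of_rpow (reg.β k) mq hZpos
    (fun a => quarkEquiv (PL (κ a))) (fun b => quarkEquiv (PL (ρ b))) hε.le hXi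
    ((qcdPhaseQuenchedExpect_eq_integral_qcdLatticeMeasure _ _ _).trans_le hXA)
  refine ⟨hXint, ?_⟩
  have hWterm : ∀ τ : (i : Fin (r + 1)) × ((Fin (i : ℕ) → Fin r) × (Fin (i : ℕ) → Fin r)),
      Integrable (fun U => ‖((M U).submatrix τ.2.1 τ.2.2).det‖) ν ∧
        ∫ U, ‖((M U).submatrix τ.2.1 τ.2.2).det‖ ∂ν ≤ 1 + max (CM τ.1) 0 := by
    intro τ
    obtain ⟨h1, h2⟩ := hMMi τ.1 S hS (fun t => PL (κ (τ.2.1 t))) (fun t => PL (ρ (τ.2.2 t)))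
    obtain ⟨h3, h4⟩ := integrable_norm_det_inv_diracMatrix_of_rpow (reg.β k) mq hZpos
      (fun t => quarkEquiv (PL (κ (τ.2.1 t)))) (fun t => quarkEquiv (PL (ρ (τ.2.2 t)))) hε.le h1 h2
    exact ⟨h3, h4.trans (by gcongr; exact le_max_left _ _)⟩
  have hWi : Integrable W ν := integrable_finsetSum _ fun τ _ => (hWterm τ).1
  have hWB : ∫ U, W U ∂ν ≤ CW := by
    rw [hCW, hW, integral_finsetSum _ fun τ _ => (hWterm τ).1]
    exact Finset.sum_le_sum fun τ _ => (hWterm τ).2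
  have hWm : Measurable W := Finset.measurable_sum _ fun τ _ =>
    (measurable_det_inv_diracMatrix mq (fun t => quarkEquiv (PL (κ (τ.2.1 t))))
      (fun t => quarkEquiv (PL (ρ (τ.2.2 t))))).norm
  have hW0 : ∀ U, 0 ≤ W U := fun U => Finset.sum_nonneg fun _ _ => norm_nonneg _
  have hXm : Measurable X :=
    (measurable_det_inv_diracMatrix mq (fun a => quarkEquiv (PL (κ a))) (fun b => quarkEquiv (PL (ρ b)))).norm
  -- (2)-(3) crossing pairs, their geometry and domination by two-point block sums
  set t : ℝ := max ((n : ℝ) - ((R : ℝ) + R')) 0 with ht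
  set BS : Fin Nf → TorusSite 4 (2 * S + 1) → Literature.Probability.LatticeModels.Site 4 →
      GaugeConfig 4 (2 * S + 1) SU3 → ℝ := fun f x v U =>
    ∑ a : Fin 3, ∑ i : Fin 4, ∑ b : Fin 3, ∑ j : Fin 4,
      ‖(diracMatrix U mq)⁻¹ (quarkEquiv (f, (x, a, i)))
        (quarkEquiv (f, (x + Torus.proj (2 * S + 1) v, b, j)))‖ with hBS
  have hpair : ∀ p : {p : Fin r × Fin r // Sum.isLeft (κ p.1) ≠ Sum.isLeft (ρ p.2)},
      ∃ (f : Fin Nf) (x : TorusSite 4 (2 * S + 1)) (v : Literature.Probability.LatticeModels.Site 4),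
        v ∈ box 4 S ∧ t ≤ ‖v‖ ∧ ∀ U, ‖M U p.1.1 p.1.2‖ ≤ BS f x v U := by
    rintro ⟨⟨a, b⟩, hab⟩
    change ∃ f x v, v ∈ box 4 S ∧ t ≤ ‖v‖ ∧
      ∀ U, ‖(diracMatrix U mq)⁻¹ (quarkEquiv (PL (κ a))) (quarkEquiv (PL (ρ b)))‖ ≤ BS f x v U
    dsimp only at hab
    rcases hκa : κ a with ⟨fa, ua, ca, sa⟩ | ⟨fa, ua, ca, sa⟩ <;>
      rcases hρb : ρ b with ⟨fb, ub, cb, sb⟩ | ⟨fb, ub, cb, sb⟩ <;>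
      simp only [hκa, hρb, Sum.isLeft_inl, Sum.isLeft_inr, ne_eq, not_true_eq_false] at hab
    · obtain ⟨v, hv, hvn, hproj⟩ := Torus.exists_box_shift_eq_add_proj (0 : Fin 4) hn ua.2 ub.2
      refine ⟨fa, Torus.proj (2 * S + 1) (ua : Literature.Probability.LatticeModels.Site 4), v, hv,
        max_le hvn (norm_nonneg _), fun U => ?_⟩
      simp only [hPL, hBS, Sum.elim_inl, Sum.elim_inr, hproj]
      exact norm_inv_diracMatrix_apply_le_blockSum U mq fa fb _ _ ca sa cb sb
    · obtain ⟨v, hv, hvn, hproj⟩ := Torus.exists_box_eq_shift_add_proj (0 : Fin 4) hn ub.2 ua.2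
      refine ⟨fa, Torus.proj (2 * S + 1)
        ((ua : Literature.Probability.LatticeModels.Site 4) + Pi.single 0 (n : ℤ)), v, hv,
        max_le hvn (norm_nonneg _), fun U => ?_⟩
      simp only [hPL, hBS, Sum.elim_inl, Sum.elim_inr, hproj]
      exact norm_inv_diracMatrix_apply_le_blockSum U mq fa fb _ _ ca sa cb sb
  choose fsel xsel vsel hbox hvt hle using hpair
  -- (4) the algebraic implication off the rare event
  have hPL1 : ∀ z, (PL z).1 = fl z := by rintro (z | z) <;> rfl
  have halg : ∀ U η, 0 < η → η ≤ 1 →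
      (∀ p : {p : Fin r × Fin r // Sum.isLeft (κ p.1) ≠ Sum.isLeft (ρ p.2)}, ‖M U p.1.1 p.1.2‖ ≤ η) →
        X U ≤ η * (K r * W U ^ 2) := by
    intro U η hη0 hη1 hp
    have hoff : ∀ a b, fl (κ a) ≠ fl (ρ b) → M U a b = 0 := fun a b hab =>
      inv_diracMatrix_apply_eq_zero_of_fst_ne U mq (by rwa [hPL1, hPL1])
    have hcr : ∀ a b, Sum.isLeft (κ a) ≠ Sum.isLeft (ρ b) → ‖M U a b‖ ≤ η := fun a b hab =>
      hp ⟨(a, b), hab⟩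
    have h1 := hCL r (Fin Nf) (M U) (fun a => fl (κ a)) (fun b => fl (ρ b)) (fun a => Sum.isLeft (κ a))
      (fun b => Sum.isLeft (ρ b)) f₀ η hη0.le hη1 hoff hcr
    have h2 := twoSidedLaplace_sum_le_sq (M U) (fun a => Sum.isLeft (κ a)) (fun b => Sum.isLeft (ρ b))
    have e1 : (Finset.univ.filter fun a => fl (κ a) = f₀ ∧ Sum.isLeft (κ a) = true) =
        Finset.univ.filter fun a => Sum.isLeft (κ a) = true ∧ fl (κ a) = f₀ :=
      Finset.filter_congr fun a _ => and_comm
    have e2 : (Finset.univ.filter fun b => fl (ρ b) = f₀ ∧ Sum.isLeft (ρ b) = true) =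
        Finset.univ.filter fun b => Sum.isLeft (ρ b) = true ∧ fl (ρ b) = f₀ :=
      Finset.filter_congr fun b _ => and_comm
    rw [e1, e2] at h1
    have hN1 := Int.natAbs_pos.2 hq
    calc X U = ‖(M U).det‖ := rfl
      _ ≤ _ := h1
      _ ≤ η ^ 1 * K r * W U ^ 2 :=
          mul_le_mul (mul_le_mul_of_nonneg_right (pow_le_pow_of_le_one hη0.le hη1 hN1) (hK0 r)) h2
            (by positivity) (by have := hK0 r; positivity)
      _ = η * (K r * W U ^ 2) := by rw [pow_one, mul_assoc]
  -- (5) the abstract transfer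
  have hN : (Fintype.card {p : Fin r × Fin r // Sum.isLeft (κ p.1) ≠ Sum.isLeft (ρ p.2)} : ℝ) ≤ (r : ℝ) ^ 2 := by
    have h := Fintype.card_subtype_le fun p : Fin r × Fin r => Sum.isLeft (κ p.1) ≠ Sum.isLeft (ρ p.2)
    rw [Fintype.card_prod, Fintype.card_fin, ← sq] at h
    exact_mod_cast h
  have hmain := integral_le_exp_of_crossing_split ν (hSplit _ ν)
    (fun p U => ‖M U p.1.1 p.1.2‖) (fun p U => BS (fsel p) (xsel p) (vsel p) U) X W
    (CT := CT') (x := δ * (reg.a k * t)) hε hs0 hs1 (hK0 r)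
    (mul_nonneg hδ.le (mul_nonneg hak.le (le_max_right _ _))) hCT0 hN
    (fun U => norm_nonneg _) hXm hXi (hXA.trans ((le_max_left (CM r) 0).trans_eq hCA.symm)) hW0 hWm hWi hWB
    (fun p U => norm_nonneg _) (fun p => (measurable_inv_diracMatrix_apply mq _ _).norm) hle
    (fun p => (hTPk S hS (fsel p) (xsel p) (vsel p) (hbox p)).1)
    (fun p => by
      have h := (hTPk S hS (fsel p) (xsel p) (vsel p) (hbox p)).2
      rw [qcdPhaseQuenchedExpect_eq_integral_qcdLatticeMeasure] at h
      refine h.trans ?_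
      have h3 : -(δ * (reg.a k * ‖vsel p‖)) ≤ -(δ * (reg.a k * t)) :=
        neg_le_neg (mul_le_mul_of_nonneg_left (mul_le_mul_of_nonneg_left (hvt p) hak.le) hδ.le)
      calc CT * Real.exp (-(δ * (reg.a k * ‖vsel p‖))) ≤ CT' * Real.exp (-(δ * (reg.a k * ‖vsel p‖))) :=
            mul_le_mul_of_nonneg_right (by rw [hCT']; exact le_max_left _ _) (Real.exp_pos _).le
        _ ≤ CT' * Real.exp (-(δ * (reg.a k * t))) :=
            mul_le_mul_of_nonneg_left (Real.exp_le_exp.2 h3) hCT0)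
    halg
  rw [← hγ, ← hK₀] at hmain
  refine hmain.trans ?_
  rw [mul_assoc, ← Real.exp_add]
  refine mul_le_mul_of_nonneg_left (Real.exp_le_exp.2 ?_) hK₀0
  have h1 : reg.a k * ((n : ℝ) - ((R : ℝ) + R')) ≤ reg.a k * t :=
    mul_le_mul_of_nonneg_left (le_max_left _ _) hak.le
  have h2 : reg.a k * ((R : ℝ) + R') ≤ (R : ℝ) + R' := mul_le_of_le_one_left (by positivity) ha1k
  have hγδ : 0 ≤ γ * δ := (mul_pos hγ0 hδ).le
  have h3 := mul_le_mul_of_nonneg_left h1 hγδ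
  have h4 := mul_le_mul_of_nonneg_left h2 hγδ
  linarith

end Summit.QuantumFields.QCD.Cruxes.PhaseQuenchedFlavourDecay.CrossingSplitIntegrability

end
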